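import Mathlib
import HarnessLib
import Summits.RiemannHypothesis.RiemannHypothesis.Theorems.IntegerScrewHarmonicMoves

/-!
# Route `IntegerScrew` — THE DEATH IDENTITY of the exact decomposition 16.4: the walk's deaths against `∂_u h̃`
# leave exactly `−I(u,ρ_x)·Π(u;x)` (CONTINUUM-LIMIT 16.4 (i)–(ii), 16.7 (i))

CONTINUUM-LIMIT 16.4 decomposes `(𝒜_D − ∂_u)h̃` at a state `x`; its structural core («the heart», guide §K (K3)
(i)–(ii)) is that the DEATH moves `x → x/p^b` (rate `θ_p = log p/L` for each `1 ≤ b ≤ v_p(x)`) together with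
`−∂_u h̃` cancel down to the single term `−I(u,ρ_x)·Π(u;x)`: the full deaths' «second pieces» cancel `K·∂_uΠ`,
and the three `e^{−uρ}c(u)`-groups (full deaths' first pieces, partial deaths, and the `(1−ρ)e^{−uρ}c` of (H2))
sum to ZERO identically — «the walk's partial deaths exactly compensate the non-squarefree defect of the room».
This file proves that identity in the kernel, prime by prime:

* `one_sub_exp_mul_geom_sum` — `(1 − e^{−uθ})·Σ_{b<v} e^{−ubθ} = 1 − e^{−uvθ}`;
* `deathTerms_prime` — for `p ∣ x`: `Σ_{b=1}^{v_p} θ_p (h̃(u;x/p^b) − h̃(u;x)) − K(u,ρ_x)·Π′_p·θ_p e^{−uθ_p}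
  = v_p θ_p e^{−uρ_x} c(u)·Π(u;x)` (`Π′_p = Π(u; x/p^{v_p})`);
* **`deaths_sub_hTildeDeriv`** — `Σ_{p∣x} Σ_{b=1}^{v_p(x)} (log p/L)(h̃(u;x/p^b) − h̃(u;x)) − ∂_u h̃(u;x)
  = −I(u,ρ_x)·Π(u;x)` for every `x ≥ 1`, `u ≠ 0` (births are a separate, additive matter);
* `sum_divisors_vonMangoldt_mul` (`Σ_{d∣x}Λ(d)G(d) = Σ_{p∣x}Σ_{b≤v_p}log p·G(p^b)`) and
  **`divisor_deaths_sub_hTildeDeriv`** — the same identity with the deaths written as the generator presents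
  them, `Σ_{d ∣ x} Λ(d)/L·(h̃(u;x/d) − h̃(u;x))` (`IntegerScrewWalkGenerator.walkGen_sum_eq_arith`);
* `deathTerms_prime_hPrime`, **`divisor_deaths_sub_hPrimeDeriv`** — the same for `h′ = h̃W`:
  `Σ_{d∣x}Λ(d)/L·(h′(x/d) − h′(x)) − ∂_u h′ = −W·[IΠ + Σ_{p∣x}(θ_p/p)h̃(x/p^{v_p})]` (the last sum is
  16.4's `Π·N_death`).

Inputs: (H1)/(H2) (`IntegerScrewHarmonicK`), the move rules (`IntegerScrewHarmonicMoves`, `…WalkStates`),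
`log x = Σ_p v_p(x) log p`.  RH-free.  Nothing here bears on the truth of RH.  References: CONTINUUM-LIMIT §16.3–16.4,
§21.1 (K3) (rh-explicit); M. Suzuki, J. Lond. Math. Soc. (2) 108 (2023) 1448–1487 [Suzuki2023].
-/

noncomputable section

-- D-0017: `Summit.<S>.<S>.…` is the designed namespace of a single-problem summit.
set_option linter.dupNamespace false

namespace Summit.RiemannHypothesis.RiemannHypothesis.Theorems.IntegerScrew

open Finset

/-- `(1 − e^{−uθ})·Σ_{b<v} e^{−u·bθ} = 1 − e^{−u·vθ}` (finite geometric sum). -/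
theorem one_sub_exp_mul_geom_sum (u θ : ℝ) (v : ℕ) :
    (1 - Real.exp (-(u * θ))) * ∑ b ∈ Finset.range v, Real.exp (-(u * ((b : ℝ) * θ))) =
      1 - Real.exp (-(u * ((v : ℝ) * θ))) := by
  have h : ∀ b : ℕ, Real.exp (-(u * ((b : ℝ) * θ))) = Real.exp (-(u * θ)) ^ b := by
    intro b
    rw [← Real.exp_nat_mul]
    ring_nf
  simp_rw [h]
  exact mul_neg_geom_sum _ _

/-- **The death terms of one prime.**  For `p ∣ x` (`v = v_p(x)`, `θ = log p/L`, `ρ = ρ_x`,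
`Π′ = Π(u; x/p^v)`): `Σ_{b=1}^{v} θ·(h̃(u;x/p^b) − h̃(u;x)) − K(u,ρ)·Π′·θe^{−uθ} = v·θ·e^{−uρ}c(u)·Π(u;x)`. -/
theorem deathTerms_prime (L : ℝ) {u : ℝ} (hu : u ≠ 0) {x p : ℕ} (hx : x ≠ 0) (hp : p.Prime) (hpx : p ∣ x) :
    (∑ b ∈ Finset.Icc 1 (x.factorization p),
        (Real.log p / L) * (hTilde L u (x / p ^ b) - hTilde L u x)) -
      ccpK u (room L x) * (primeProd L u (x / p ^ x.factorization p) *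
        ((Real.log p / L) * Real.exp (-(u * (Real.log p / L))))) =
      (x.factorization p : ℝ) * (Real.log p / L) * (Real.exp (-(u * room L x)) * ccpc u) *
        primeProd L u x := by
  set v := x.factorization p with hvdef
  have hv : 1 ≤ v := (hp.dvd_iff_one_le_factorization hx).1 hpx
  set θ := Real.log p / L with hθ
  set ρ := room L x with hρ
  set P' := primeProd L u (x / p ^ v) with hP'
  have hPi : primeProd L u x = P' * (1 - Real.exp (-(u * θ))) := primeProd_eq_ordCompl_mul L u hx hp hpx
  -- the top term b = v and the partial terms b < v
  obtain ⟨w, hw⟩ : ∃ w, v = w + 1 := ⟨v - 1, by omega⟩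
  have hsplit : (∑ b ∈ Finset.Icc 1 v, θ * (hTilde L u (x / p ^ b) - hTilde L u x)) =
      (∑ b ∈ Finset.Ico 1 v, θ * (hTilde L u (x / p ^ b) - hTilde L u x)) +
        θ * (hTilde L u (x / p ^ v) - hTilde L u x) := by
    rw [hw, ← Finset.sum_Ico_succ_top (by omega : 1 ≤ w + 1)]
    rfl
  -- partial deaths: h̃(x/p^b) = K(ρ + bθ)·Π and K(ρ+bθ) − K(ρ) = (1 − e^{−ubθ}) e^{−uρ} c
  have hpartial : ∀ b ∈ Finset.Ico 1 v, θ * (hTilde L u (x / p ^ b) - hTilde L u x) =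
      θ * ((1 - Real.exp (-(u * ((b : ℝ) * θ)))) * Real.exp (-(u * ρ)) * ccpc u) * primeProd L u x := by
    intro b hb
    have hb' : b < x.factorization p := (Finset.mem_Ico.1 hb).2
    rw [hTilde_div_partial L u hx hp hb']
    unfold hTilde
    rw [← hρ, ← ccpK_add_sub hu ρ ((b : ℝ) * θ)]
    ring
  -- full death: h̃(x/p^v) = K(ρ + vθ)·Π′
  have hfull : hTilde L u (x / p ^ v) = ccpK u (ρ + (v : ℝ) * θ) * P' := by
    unfold hTilde
    rw [room_div_prime_pow L hx (Nat.ordProj_dvd x p)]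
  have hKv : ccpK u (ρ + (v : ℝ) * θ) = ccpK u ρ + (1 - Real.exp (-(u * ((v : ℝ) * θ)))) *
      Real.exp (-(u * ρ)) * ccpc u := by
    rw [← ccpK_add_sub hu ρ ((v : ℝ) * θ)]; ring
  -- geometric bookkeeping: Σ_{b ∈ Ico 1 v} e^{−ubθ} + 1 = Σ_{b < v} e^{−ubθ}
  have hgeom := one_sub_exp_mul_geom_sum u θ v
  have hIco : (∑ b ∈ Finset.Ico 1 v, Real.exp (-(u * ((b : ℝ) * θ)))) + 1 =
      ∑ b ∈ Finset.range v, Real.exp (-(u * ((b : ℝ) * θ))) := by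
    rw [hw, Finset.sum_range_succ', Finset.sum_Ico_eq_sum_range]
    simp only [Nat.cast_zero, zero_mul, mul_zero, neg_zero, Real.exp_zero, add_tsub_cancel_right,
      Nat.cast_add, Nat.cast_one]
    congr 1
    refine Finset.sum_congr rfl fun b _ => ?_
    ring_nf
  rw [hsplit, Finset.sum_congr rfl hpartial, hfull, hKv]
  unfold hTilde
  rw [← hρ, hPi]
  -- everything is now polynomial in the exponentials and the two sums; reduce to hgeom/hIco
  have hsum : (∑ b ∈ Finset.Ico 1 v,
      θ * ((1 - Real.exp (-(u * ((b : ℝ) * θ)))) * Real.exp (-(u * ρ)) * ccpc u) *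
        (P' * (1 - Real.exp (-(u * θ))))) =
      θ * Real.exp (-(u * ρ)) * ccpc u * P' * (1 - Real.exp (-(u * θ))) *
        ((Finset.Ico 1 v).card - ∑ b ∈ Finset.Ico 1 v, Real.exp (-(u * ((b : ℝ) * θ)))) := by
    rw [Finset.card_eq_sum_ones, Nat.cast_sum, ← Finset.sum_sub_distrib, Finset.mul_sum]
    refine Finset.sum_congr rfl fun b _ => ?_
    push_cast
    ring
  rw [hsum, Nat.card_Ico]
  have hcard : ((v - 1 : ℕ) : ℝ) = (v : ℝ) - 1 := by
    rw [Nat.cast_sub hv, Nat.cast_one]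
  rw [hcard]
  have hS : ∑ b ∈ Finset.Ico 1 v, Real.exp (-(u * ((b : ℝ) * θ))) =
      ∑ b ∈ Finset.range v, Real.exp (-(u * ((b : ℝ) * θ))) - 1 := by linarith [hIco]
  rw [hS]
  linear_combination (-(θ * Real.exp (-(u * ρ)) * ccpc u * P')) * hgeom

/-- `∏_{q ∣ x, q ≠ p} φ(θ_q) = Π(u; x/p^{v_p(x)})`. -/
theorem prod_erase_eq_primeProd_ordCompl (L u : ℝ) {x p : ℕ} (hx : x ≠ 0) (hp : p.Prime) :
    (∏ q ∈ x.primeFactors.erase p, (1 - Real.exp (-(u * (Real.log q / L))))) =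
      primeProd L u (x / p ^ x.factorization p) := by
  unfold primeProd
  rw [primeFactors_ordCompl hx hp]

/-- `Σ_{p ∣ x} v_p(x)·(log p/L) = 1 − ρ_x` (`= log x/L`). -/
theorem sum_factorization_mul_theta (L : ℝ) (x : ℕ) :
    ∑ p ∈ x.primeFactors, (x.factorization p : ℝ) * (Real.log p / L) = 1 - room L x := by
  unfold room
  have h := Real.log_nat_eq_sum_factorization x
  rw [Finsupp.sum, Nat.support_factorization] at h
  rw [sub_sub_cancel, h, Finset.sum_div]
  refine Finset.sum_congr rfl fun p _ => ?_
  ring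

/-- **THE DEATH IDENTITY** (CONTINUUM-LIMIT 16.4 (i)–(ii)): for every `x ≥ 1` and `u ≠ 0`,
`Σ_{p∣x} Σ_{b=1}^{v_p(x)} (log p/L)·(h̃(u; x/p^b) − h̃(u;x)) − ∂_u h̃(u;x) = −I(u,ρ_x)·Π(u;x)`:
the deaths of the walk and the `u`-derivative of the comparison function leave exactly the Lebesgue integral
`−∫₀^{ρ} F` of 16.4 — the full deaths' second pieces cancel `K∂_uΠ`, and the three `e^{−uρ}c(u)`-groups cancel
identically. -/
theorem deaths_sub_hTildeDeriv (L : ℝ) {u : ℝ} (hu : u ≠ 0) {x : ℕ} (hx : x ≠ 0) :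
    (∑ p ∈ x.primeFactors, ∑ b ∈ Finset.Icc 1 (x.factorization p),
        (Real.log p / L) * (hTilde L u (x / p ^ b) - hTilde L u x)) - hTildeDeriv L u x =
      -(ccpI u (room L x) * primeProd L u x) := by
  have hderiv : hTildeDeriv L u x =
      ((1 - room L x) * Real.exp (-(u * room L x)) * ccpc u + ccpI u (room L x)) * primeProd L u x +
        ∑ p ∈ x.primeFactors, ccpK u (room L x) * (primeProd L u (x / p ^ x.factorization p) *
          ((Real.log p / L) * Real.exp (-(u * (Real.log p / L))))) := by
    unfold hTildeDeriv primeProdDeriv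
    rw [Finset.mul_sum]
    congr 1
    refine Finset.sum_congr rfl fun p hp => ?_
    rw [prod_erase_eq_primeProd_ordCompl L u hx (Nat.prime_of_mem_primeFactors hp)]
  have hp : ∀ p ∈ x.primeFactors,
      (∑ b ∈ Finset.Icc 1 (x.factorization p), (Real.log p / L) * (hTilde L u (x / p ^ b) - hTilde L u x)) -
        ccpK u (room L x) * (primeProd L u (x / p ^ x.factorization p) *
          ((Real.log p / L) * Real.exp (-(u * (Real.log p / L))))) =
      (x.factorization p : ℝ) * (Real.log p / L) * (Real.exp (-(u * room L x)) * ccpc u) * primeProd L u x :=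
    fun p hp => deathTerms_prime L hu hx (Nat.prime_of_mem_primeFactors hp) (Nat.dvd_of_mem_primeFactors hp)
  have hAC : (∑ p ∈ x.primeFactors, ∑ b ∈ Finset.Icc 1 (x.factorization p),
        (Real.log p / L) * (hTilde L u (x / p ^ b) - hTilde L u x)) -
      (∑ p ∈ x.primeFactors, ccpK u (room L x) * (primeProd L u (x / p ^ x.factorization p) *
          ((Real.log p / L) * Real.exp (-(u * (Real.log p / L)))))) =
      (1 - room L x) * (Real.exp (-(u * room L x)) * ccpc u) * primeProd L u x := by
    rw [← Finset.sum_sub_distrib, Finset.sum_congr rfl hp, ← sum_factorization_mul_theta L x, Finset.sum_mul,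
      Finset.sum_mul]
  rw [hderiv]
  linear_combination hAC

/-! ## From the divisor form `Σ_{d ∣ x} Λ(d)·G(d)` to the `(p, b)` form -/

/-- `Σ_{d ∣ x} Λ(d)·G(d) = Σ_{p ∣ x} Σ_{b=1}^{v_p(x)} log p·G(p^b)`: the von Mangoldt weight keeps exactly the
prime-power divisors, indexed by (prime, exponent). -/
theorem sum_divisors_vonMangoldt_mul {x : ℕ} (hx : x ≠ 0) (G : ℕ → ℝ) :
    ∑ d ∈ x.divisors, (ArithmeticFunction.vonMangoldt d : ℝ) * G d =
      ∑ p ∈ x.primeFactors, ∑ b ∈ Finset.Icc 1 (x.factorization p), Real.log p * G (p ^ b) := by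
  classical
  -- the index set of pairs and the map (p, b) ↦ p^b
  set S : Finset (Σ _ : ℕ, ℕ) := x.primeFactors.sigma fun p => Finset.Icc 1 (x.factorization p) with hS
  have hinj : ∀ a ∈ S, ∀ a' ∈ S, (fun s : Σ _ : ℕ, ℕ => s.1 ^ s.2) a = (fun s : Σ _ : ℕ, ℕ => s.1 ^ s.2) a' →
      a = a' := by
    rintro ⟨p, b⟩ ha ⟨q, c⟩ ha' h
    simp only [hS, Finset.mem_sigma, Finset.mem_Icc] at ha ha'
    have hp : p.Prime := Nat.prime_of_mem_primeFactors ha.1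
    have hq : q.Prime := Nat.prime_of_mem_primeFactors ha'.1
    simp only at h
    have hpq : p = q := by
      have h1 := congrArg Nat.minFac h
      rwa [hp.pow_minFac (by omega), hq.pow_minFac (by omega)] at h1
    subst hpq
    have hbc : b = c := Nat.pow_right_injective hp.two_le h
    subst hbc
    rfl
  -- the image is the set of prime-power divisors; Λ vanishes on the other divisors
  have himage : S.image (fun s : Σ _ : ℕ, ℕ => s.1 ^ s.2) ⊆ x.divisors := by
    intro d hd
    rw [Finset.mem_image] at hd
    obtain ⟨⟨p, b⟩, hs, rfl⟩ := hd
    simp only [hS, Finset.mem_sigma, Finset.mem_Icc] at hs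
    have hp : p.Prime := Nat.prime_of_mem_primeFactors hs.1
    exact Nat.mem_divisors.2 ⟨(hp.pow_dvd_iff_le_factorization hx).2 hs.2.2, hx⟩
  have hzero : ∀ d ∈ x.divisors, d ∉ S.image (fun s : Σ _ : ℕ, ℕ => s.1 ^ s.2) →
      (ArithmeticFunction.vonMangoldt d : ℝ) * G d = 0 := by
    intro d hd hnot
    have hnpp : ¬ IsPrimePow d := by
      intro hpp
      obtain ⟨p, k, hp, hk, rfl⟩ := (isPrimePow_nat_iff d).1 hpp
      apply hnot
      rw [Finset.mem_image]
      refine ⟨⟨p, k⟩, ?_, rfl⟩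
      simp only [hS, Finset.mem_sigma, Finset.mem_Icc]
      have hdvd : p ^ k ∣ x := (Nat.mem_divisors.1 hd).1
      refine ⟨Nat.mem_primeFactors.2 ⟨hp, (dvd_pow_self p (by omega)).trans hdvd, hx⟩, by omega, ?_⟩
      exact (hp.pow_dvd_iff_le_factorization hx).1 hdvd
    rw [ArithmeticFunction.vonMangoldt_eq_zero_iff.2 hnpp, zero_mul]
  rw [← Finset.sum_subset himage hzero, Finset.sum_image hinj, hS, Finset.sum_sigma]
  refine Finset.sum_congr rfl fun p hp => Finset.sum_congr rfl fun b hb => ?_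
  have hpr : p.Prime := Nat.prime_of_mem_primeFactors hp
  have hb1 : b ≠ 0 := by have := (Finset.mem_Icc.1 hb).1; omega
  simp only
  rw [ArithmeticFunction.vonMangoldt_apply_pow hb1, ArithmeticFunction.vonMangoldt_apply_prime hpr]

/-- **THE DEATH IDENTITY in divisor form** (the death half of CONTINUUM-LIMIT 16.4, as the walk's generator
presents it: `Σ_{d ∣ x} Λ(d)/L·(h̃(u;x/d) − h̃(u;x)) − ∂_u h̃(u;x) = −I(u,ρ_x)·Π(u;x)`). -/
theorem divisor_deaths_sub_hTildeDeriv (L : ℝ) {u : ℝ} (hu : u ≠ 0) {x : ℕ} (hx : x ≠ 0) :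
    (∑ d ∈ x.divisors, (ArithmeticFunction.vonMangoldt d : ℝ) / L * (hTilde L u (x / d) - hTilde L u x)) -
        hTildeDeriv L u x =
      -(ccpI u (room L x) * primeProd L u x) := by
  have h := sum_divisors_vonMangoldt_mul hx (fun d => (1 / L) * (hTilde L u (x / d) - hTilde L u x))
  have h1 : (∑ d ∈ x.divisors, (ArithmeticFunction.vonMangoldt d : ℝ) / L * (hTilde L u (x / d) - hTilde L u x)) =
      ∑ d ∈ x.divisors, (ArithmeticFunction.vonMangoldt d : ℝ) * ((1 / L) * (hTilde L u (x / d) - hTilde L u x)) :=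
    Finset.sum_congr rfl fun d _ => by ring
  have h2 : (∑ p ∈ x.primeFactors, ∑ b ∈ Finset.Icc 1 (x.factorization p),
      Real.log p * ((1 / L) * (hTilde L u (x / p ^ b) - hTilde L u x))) =
      ∑ p ∈ x.primeFactors, ∑ b ∈ Finset.Icc 1 (x.factorization p),
        (Real.log p / L) * (hTilde L u (x / p ^ b) - hTilde L u x) :=
    Finset.sum_congr rfl fun p _ => Finset.sum_congr rfl fun b _ => by ring
  rw [h1, h, h2]
  exact deaths_sub_hTildeDeriv L hu hx

/-! ## The same for `h′ = h̃·W`: the extra term `−N_death` of 16.4 -/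

/-- Per prime: `Σ_{b=1}^{v} θ (h′(x/p^b) − h′(x)) = W(x)·Σ_{b=1}^{v} θ (h̃(x/p^b) − h̃(x)) − (θ/p)·W(x)·h̃(x/p^{v})`
(only the full death changes `W`, by the factor `(p−1)/p`). -/
theorem deathTerms_prime_hPrime (L u : ℝ) {x p : ℕ} (hx : x ≠ 0) (hp : p.Prime) (hpx : p ∣ x) :
    (∑ b ∈ Finset.Icc 1 (x.factorization p), (Real.log p / L) * (hPrime L u (x / p ^ b) - hPrime L u x)) =
      wProd x * (∑ b ∈ Finset.Icc 1 (x.factorization p),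
          (Real.log p / L) * (hTilde L u (x / p ^ b) - hTilde L u x)) -
        (Real.log p / L) / p * wProd x * hTilde L u (x / p ^ x.factorization p) := by
  set v := x.factorization p with hvdef
  have hv : 1 ≤ v := (hp.dvd_iff_one_le_factorization hx).1 hpx
  have hWv : wProd x = wProd (x / p ^ v) * ((p : ℝ) / ((p : ℝ) - 1)) := wProd_eq_ordCompl_mul hx hp hpx
  have hp1 : (p : ℝ) - 1 ≠ 0 := by
    have : (2 : ℝ) ≤ p := by exact_mod_cast hp.two_le
    linarith
  have hp0 : (p : ℝ) ≠ 0 := by exact_mod_cast hp.ne_zero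
  have hW' : wProd (x / p ^ v) - wProd x = -(wProd x / p) := by
    rw [hWv]; field_simp; ring
  have hterm : ∀ b ∈ Finset.Icc 1 v, (Real.log p / L) * (hPrime L u (x / p ^ b) - hPrime L u x) =
      wProd x * ((Real.log p / L) * (hTilde L u (x / p ^ b) - hTilde L u x)) +
        (Real.log p / L) * (wProd (x / p ^ b) - wProd x) * hTilde L u (x / p ^ b) := by
    intro b _
    unfold hPrime
    ring
  have hsingle : (∑ b ∈ Finset.Icc 1 v, (Real.log p / L) * (wProd (x / p ^ b) - wProd x) * hTilde L u (x / p ^ b)) =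
      (Real.log p / L) * (wProd (x / p ^ v) - wProd x) * hTilde L u (x / p ^ v) := by
    refine Finset.sum_eq_single_of_mem v (Finset.mem_Icc.2 ⟨hv, le_rfl⟩) fun b hb hbv => ?_
    have hb' : b < x.factorization p := lt_of_le_of_ne (Finset.mem_Icc.1 hb).2 hbv
    rw [wProd_div_of_lt hx hp hb', sub_self, mul_zero, zero_mul]
  rw [Finset.sum_congr rfl hterm, Finset.sum_add_distrib, ← Finset.mul_sum, hsingle, hW']
  ring

/-- **THE DEATH IDENTITY for `h′`** (CONTINUUM-LIMIT 16.4, the `W`-weighted function): for `x ≥ 1`, `u ≠ 0`,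
`Σ_{d∣x} Λ(d)/L·(h′(u;x/d) − h′(u;x)) − ∂_u h′(u;x) = −W(x)·[I(u,ρ_x)·Π(u;x) + Σ_{p∣x}(θ_p/p)·h̃(u;x/p^{v_p})]`
— the last sum is `Π·N_death` of 16.4 (`h̃(u;x/p^{v_p}) = K(u,ρ_x + v_pθ_p)·Π/φ(θ_p)`). -/
theorem divisor_deaths_sub_hPrimeDeriv (L : ℝ) {u : ℝ} (hu : u ≠ 0) {x : ℕ} (hx : x ≠ 0) :
    (∑ d ∈ x.divisors, (ArithmeticFunction.vonMangoldt d : ℝ) / L * (hPrime L u (x / d) - hPrime L u x)) -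
        hPrimeDeriv L u x =
      -(wProd x * (ccpI u (room L x) * primeProd L u x +
        ∑ p ∈ x.primeFactors, (Real.log p / L) / p * hTilde L u (x / p ^ x.factorization p))) := by
  have h := sum_divisors_vonMangoldt_mul hx (fun d => (1 / L) * (hPrime L u (x / d) - hPrime L u x))
  have h1 : (∑ d ∈ x.divisors, (ArithmeticFunction.vonMangoldt d : ℝ) / L * (hPrime L u (x / d) - hPrime L u x)) =
      ∑ d ∈ x.divisors, (ArithmeticFunction.vonMangoldt d : ℝ) * ((1 / L) * (hPrime L u (x / d) - hPrime L u x)) :=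
    Finset.sum_congr rfl fun d _ => by ring
  have h2 : (∑ p ∈ x.primeFactors, ∑ b ∈ Finset.Icc 1 (x.factorization p),
      Real.log p * ((1 / L) * (hPrime L u (x / p ^ b) - hPrime L u x))) =
      ∑ p ∈ x.primeFactors, ∑ b ∈ Finset.Icc 1 (x.factorization p),
        (Real.log p / L) * (hPrime L u (x / p ^ b) - hPrime L u x) :=
    Finset.sum_congr rfl fun p _ => Finset.sum_congr rfl fun b _ => by ring
  rw [h1, h, h2]
  have h3 : ∀ p ∈ x.primeFactors,
      (∑ b ∈ Finset.Icc 1 (x.factorization p), (Real.log p / L) * (hPrime L u (x / p ^ b) - hPrime L u x)) =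
      wProd x * (∑ b ∈ Finset.Icc 1 (x.factorization p),
          (Real.log p / L) * (hTilde L u (x / p ^ b) - hTilde L u x)) -
        (Real.log p / L) / p * wProd x * hTilde L u (x / p ^ x.factorization p) :=
    fun p hp => deathTerms_prime_hPrime L u hx (Nat.prime_of_mem_primeFactors hp) (Nat.dvd_of_mem_primeFactors hp)
  rw [Finset.sum_congr rfl h3, Finset.sum_sub_distrib, ← Finset.mul_sum]
  have h4 := deaths_sub_hTildeDeriv L hu hx
  unfold hPrimeDeriv
  have h5 : ∑ p ∈ x.primeFactors, (Real.log p / L) / p * wProd x * hTilde L u (x / p ^ x.factorization p) =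
      wProd x * ∑ p ∈ x.primeFactors, (Real.log p / L) / p * hTilde L u (x / p ^ x.factorization p) := by
    rw [Finset.mul_sum]
    exact Finset.sum_congr rfl fun p _ => by ring
  rw [h5]
  linear_combination (wProd x) * h4

end Summit.RiemannHypothesis.RiemannHypothesis.Theorems.IntegerScrew

end
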